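import Literature.Probability.RandomPlanarGeometry.HexSAWStripSurfaceArchCut
import Literature.Probability.RandomPlanarGeometry.HexSAWStripPairsTransfer
import HarnessLib

/-!
# `ε`-walks of the strip `S_{T,L}` with surface weights: anatomy and the last-contact split
# (BBdGDCG 2014, proof of Proposition 9 — the injections)

Topic `Literature/Probability/RandomPlanarGeometry` (continues `HexSAWStripSurfaceArchCut.lean` — `HV.stripGFy`,
`HV.surfContacts`, the last-contact index `HV.lcIdx` / `lcIdx_spec` — and `HexSAWStripPairsTransfer.lean` — `toPair`).
Source: N. R. Beaton, M. Bousquet-Mélou, J. de Gier, H. Duminil-Copin, A. J. Guttmann, *The critical fugacity for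
surface adsorption of self-avoiding walks on the honeycomb lattice is `1 + √2`*, Comm. Math. Phys. 326 (2014)
727–754, arXiv:1109.0358v5, proof of Proposition 9 (§4.3, p. 14): "`E_{T,L}(x_c; y)` counts some
self-avoiding walks of length at least `L`" (printed mechanism from there: Corollary 8 — the generating function of walks in the
strip converges, so "its remainder of order L tends to 0").  MECHANISM HERE (the lane's): split the walk at its LAST contact with the
surface (the last-contact cut is printed for arches, §4.5 p. 15): the prefix is a bridge carrying all the contacts, the remaining
part is a self-avoiding walk of the strip of height `T − 1`, controlled by HEX-STRIP-STRICT sub-criticality.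

## What is proved

* `epsWalks`, `eps_anatomy` (an `ε`-walk of `S_{T,L}` visits `≥ L + 1` vertices), `eps_exit_unique`;
* `spTarget` (the counting target `Σ_{k ≤ N} stripPairs (T−1) k`), `sum_spTarget`, `sum_spTarget_filter`;
* `sum_eps_noContact_le` — contact-free `ε`-walks weigh at most `Σ_{L ≤ k ≤ N} c_k(S_{T−1}) x_c^k`;
* `eps_contact_anatomy`, `EpsBig`, `pairWt`, `sum_eps_contact_le` — `ε`-walks with contacts inject, weight-preservingly,
  into (bridge of `S_{T,L}` carrying the contacts) × (tagged strip pair), with a long prefix or a long suffix.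
-/

noncomputable section

open Finset Filter Topology Literature.Probability.LatticeModels Literature.Probability.Percolation SimpleGraph

namespace Literature.Probability.RandomPlanarGeometry.SAW.HV

section EpsWalks

variable {T L : ℕ}

/-- Along an edge of `ℍ` the first coordinate changes by at most one. [cite: DuminilCopinSmirnov2012, §3] -/
private theorem abs_fst_sub_le_of_adj {u v : HV} (h : hvGraph.Adj u v) : |v.1 - u.1| ≤ 1 := by
  obtain ⟨a, b, c⟩ := u
  obtain ⟨a', b', c'⟩ := v
  rw [abs_le]
  cases c <;> cases c' <;> simp [hvGraph_adj, AdjRel] at h ⊢ <;> omega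

/-- In a chain from `O`, the `i`-th vertex has first coordinate of absolute value `≤ i`. [cite: DuminilCopinSmirnov2012, §3] -/
private theorem abs_fst_getElem_le {l : List HV} (hc : l.IsChain hvGraph.Adj) (hh : l.head? = some hvOrigin) :
    ∀ (i : ℕ) (hi : i < l.length), |(l[i]).1| ≤ i := by
  intro i
  induction i with
  | zero =>
    intro hi
    cases l with
    | nil => simp at hi
    | cons a l => simp only [List.head?_cons, Option.some.injEq] at hh; subst hh; simp [hvOrigin]
  | succ i ih =>
    intro hi
    have h1 := ih (by omega)
    have h2 := abs_fst_sub_le_of_adj (hc.getElem i hi)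
    rw [abs_le] at h1 h2 ⊢
    push_cast
    constructor <;> linarith [h1.1, h1.2, h2.1, h2.2]

/-- **An `ε`-walk of `S_{T,L}` visits at least `L + 1` vertices** (it reaches the oblique cut at lateral distance `L`).
[cite: BeatonBousquetMelouDeGierDuminilCopinGuttmann2014, proof of Proposition 9 (§4.3, arXiv v5 p. 14: "E_{T,L}(x_c;y) counts some self-avoiding walks of length at least L")] -/
theorem eps_anatomy {P : List HV} (hP : P ∈ (midWalks (stripV T L)).filter fun P => IsEpsDart L (finalDart P)) :
    ∃ (l : List HV) (u : HV) (hl : l ≠ []), P = wOut :: (l ++ [u]) ∧ l.IsChain hvGraph.Adj ∧ l.head? = some hvOrigin ∧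
      l.Nodup ∧ (∀ x ∈ l, x ∈ stripV T L) ∧ IsEpsDart L (l.getLast hl, u) ∧ L + 1 ≤ l.length := by
  rw [mem_filter, mem_midWalks_iff] at hP
  obtain ⟨hmw, hε⟩ := hP
  rcases hmw.trivial_or_exists with rfl | ⟨l, u, hl, rfl⟩
  · exact absurd hε (not_isEpsDart_trivial L)
  rw [finalDart_cons_append hl] at hε
  obtain ⟨hc, hh, -, hV, hnd, -⟩ := (isMidWalk_cons_append_iff _ hl _).1 hmw
  refine ⟨l, u, hl, rfl, hc, hh, hnd, hV, hε, ?_⟩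
  have hlen : 0 < l.length := List.length_pos_of_ne_nil hl
  have h := abs_fst_getElem_le hc hh (l.length - 1) (by omega)
  rw [← List.getLast_eq_getElem hl] at h
  have hz := hV _ (List.getLast_mem hl)
  rw [mem_stripV_iff] at hz
  obtain ⟨-, hx⟩ := hε
  dsimp only at hx
  rw [abs_le] at h
  push_cast [hlen] at h
  rcases hx with ⟨h1, -⟩ | ⟨h1, -⟩
  · have : 0 ≤ (l.getLast hl).2.1 := hz.1
    have hb : 0 ≤ bit (l.getLast hl) := by unfold bit; split_ifs <;> norm_num
    omega
  · omega

/-- The exit vertex of an `ε`-walk is determined by its last inner vertex. [cite: DuminilCopinSmirnov2012, §3 (ε, ε̄)] -/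
theorem eps_exit_unique {z u u' : HV} (hz : 0 ≤ z.2.1) (h : IsEpsDart L (z, u)) (h' : IsEpsDart L (z, u')) :
    u = u' := by
  obtain ⟨-, hx⟩ := h
  obtain ⟨-, hx'⟩ := h'
  dsimp only at hx hx'
  rcases hx with ⟨h1, h2⟩ | ⟨h1, h2⟩ <;> rcases hx' with ⟨h1', h2'⟩ | ⟨h1', h2'⟩
  · exact h2.trans h2'.symm
  · exfalso; omega
  · exfalso; omega
  · exact h2.trans h2'.symm

end EpsWalks

/-! ### The last-contact split of an `ε`-walk and the two counting injections -/

/-- The `ε`-walks of `S_{T,L}`. [cite: DuminilCopinSmirnov2012, §3 (E_{T,L})] -/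
def epsWalks (T L : ℕ) : Finset (List HV) := (midWalks (stripV T L)).filter fun P => IsEpsDart L (finalDart P)

/-- `E_{T,L}(x_c, y)` is the sum over `epsWalks`. [cite: BeatonBousquetMelouDeGierDuminilCopinGuttmann2014, §3.3 (E_{T,L}(x,y))] -/
theorem stripGFy_eps_eq (T L : ℕ) (y : ℝ) :
    stripGFy T L (IsEpsDart L) y = ∑ P ∈ epsWalks T L, hexCriticalFugacity ^ mwLen P * y ^ surfContacts T P := rfl

/-- The counting target: strip pairs of the narrower brick-wall strip `S_{T-1}` (= DCS levels `0…2T−1`) of length `≤ N`,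
tagged by their length. [cite: MadrasSlade1993, §8.2, eq. (8.2.1)] -/
def spTarget (T N : ℕ) : Finset (Σ _ : ℕ, Site 2 × (ℕ → Site 2)) :=
  (Finset.range (N + 1)).sigma fun k => HexBW.stripPairs (T - 1) k

/-- Sums over the counting target: `Σ_{σ, M ≤ k} x^k = Σ_{M ≤ k ≤ N} c_k(S_{T-1}) x^k`. [cite: MadrasSlade1993, §8.2] -/
theorem sum_spTarget_filter (T N M : ℕ) (x : ℝ) :
    ∑ σ ∈ (spTarget T N).filter (fun σ => M ≤ σ.1), x ^ σ.1 =
      ∑ k ∈ (Finset.range (N + 1)).filter (fun k => M ≤ k), (HexBW.stripCount (T - 1) k : ℝ) * x ^ k := by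
  rw [Finset.sum_filter, Finset.sum_filter, spTarget, Finset.sum_sigma]
  refine Finset.sum_congr rfl fun k _ => ?_
  dsimp only
  split_ifs with h
  · rw [Finset.sum_const, nsmul_eq_mul, HexBW.stripCount]
  · simp

/-- All of the counting target: `Σ_σ x^k = Σ_{k ≤ N} c_k x^k`. [cite: MadrasSlade1993, §8.2] -/
theorem sum_spTarget (T N : ℕ) (x : ℝ) :
    ∑ σ ∈ spTarget T N, x ^ σ.1 = ∑ k ∈ Finset.range (N + 1), (HexBW.stripCount (T - 1) k : ℝ) * x ^ k := by
  rw [spTarget, Finset.sum_sigma]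
  refine Finset.sum_congr rfl fun k _ => ?_
  dsimp only
  rw [Finset.sum_const, nsmul_eq_mul, HexBW.stripCount]

variable {T L : ℕ}

/-- A sub-list of an `ε`-walk, as a honeycomb vertex list, lies in the counting target.
[cite: MadrasSlade1993, §8.2, eq. (8.2.1)] -/
theorem toPair_mem_spTarget (hT : 1 ≤ T) {m : List HV} (hm : m ≠ []) (hc : m.IsChain hvGraph.Adj) (hnd : m.Nodup)
    (hV : ∀ x ∈ m, x ∈ stripV T L) {N : ℕ} (hN : m.length ≤ N + 1) :
    (⟨m.length - 1, toPair m⟩ : Σ _ : ℕ, Site 2 × (ℕ → Site 2)) ∈ spTarget T N := by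
  rw [spTarget, Finset.mem_sigma, Finset.mem_range]
  exact ⟨by dsimp only; have := List.length_pos_of_ne_nil hm; omega,
    toPair_mem hT hm hc hnd fun w hw => lev_mem_of_mem_stripV (hV w hw)⟩

/-- The inner list of a mid-edge walk has at most `|V|` vertices. [cite: DuminilCopinSmirnov2012, §2] -/
theorem length_inner_le {V : Finset HV} {P : List HV} (hP : IsMidWalk V P) : (inner P).length ≤ V.card := by
  rw [hP.length_inner]; exact hP.mwLen_le_card

/-- **No-contact `ε`-walks**: their total weight is at most `Σ_{L ≤ k ≤ |S_{T,L}|} c_k(S_{T-1}) x_c^k` (they carry no `y`,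
visit `≥ L+1` vertices, and are walks of the narrower strip). [cite: BeatonBousquetMelouDeGierDuminilCopinGuttmann2014, proof of Proposition 9 (§4.3, arXiv v5 p. 14)] -/
theorem sum_eps_noContact_le (hT : 1 ≤ T) (y : ℝ) :
    ∑ P ∈ (epsWalks T L).filter (fun P => ∀ x ∈ inner P, lev x ≠ 2 * (T : ℤ) - 1),
        hexCriticalFugacity ^ mwLen P * y ^ surfContacts T P ≤
      ∑ k ∈ (Finset.range ((stripV T L).card + 1)).filter (fun k => L ≤ k),
        (HexBW.stripCount (T - 1) k : ℝ) * hexCriticalFugacity ^ k := by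
  classical
  have hx := hexCriticalFugacity_pos_lt_one
  set N := (stripV T L).card
  rw [← sum_spTarget_filter]
  -- weights: no contact ⇒ `y^0`; and `x^{k+1} ≤ x^k`
  have hw : ∀ P ∈ (epsWalks T L).filter (fun P => ∀ x ∈ inner P, lev x ≠ 2 * (T : ℤ) - 1),
      hexCriticalFugacity ^ mwLen P * y ^ surfContacts T P ≤
        (fun σ : (Σ _ : ℕ, Site 2 × (ℕ → Site 2)) => hexCriticalFugacity ^ σ.1)
          ⟨(inner P).length - 1, toPair (inner P)⟩ := by
    intro P hP
    rw [Finset.mem_filter] at hP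
    obtain ⟨hP, hnc⟩ := hP
    obtain ⟨l, u, hl, rfl, -, -, -, -, -, -⟩ := eps_anatomy hP
    have h0 : surfContacts T (wOut :: (l ++ [u])) = 0 := by
      rw [surfContacts, List.length_eq_zero_iff, List.filter_eq_nil_iff]
      intro v hv; simpa using hnc v hv
    rw [h0, pow_zero, mul_one, mwLen_cons_append, inner_cons_append]
    dsimp only
    obtain ⟨k, hk⟩ : ∃ k, l.length = k + 1 := ⟨l.length - 1, by have := List.length_pos_of_ne_nil hl; omega⟩
    rw [hk, Nat.add_sub_cancel, pow_succ]
    exact mul_le_of_le_one_right (pow_nonneg hx.1.le _) hx.2.le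
  refine (Finset.sum_le_sum hw).trans ?_
  refine sum_le_sum_of_injOn_of_nonneg
    (fun P => (⟨(inner P).length - 1, toPair (inner P)⟩ : Σ _ : ℕ, Site 2 × (ℕ → Site 2)))
    ?_ ?_ (fun σ => hexCriticalFugacity ^ σ.1) (fun _ _ => pow_nonneg hx.1.le _)
  · -- injective
    intro P hP P' hP' h
    rw [Finset.coe_filter, Set.mem_setOf_eq] at hP hP'
    obtain ⟨l, u, hl, rfl, hc, hh, hnd, hV, hε, -⟩ := eps_anatomy hP.1
    obtain ⟨l', u', hl', rfl, hc', hh', hnd', hV', hε', -⟩ := eps_anatomy hP'.1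
    simp only [inner_cons_append, Sigma.mk.inj_iff] at h
    obtain ⟨hlen, hpair⟩ := h
    have hll : l = l' := toPair_inj hl hl' (by rw [hh, hh']) (by
      have := List.length_pos_of_ne_nil hl; have := List.length_pos_of_ne_nil hl'; omega) (eq_of_heq hpair)
    subst hll
    have hz := (mem_stripV_iff.1 (hV _ (List.getLast_mem hl))).1
    rw [eps_exit_unique hz hε hε']
  · -- lands in the target, with `L ≤ k`
    intro P hP
    rw [Finset.mem_filter] at hP ⊢
    obtain ⟨l, u, hl, rfl, hc, hh, hnd, hV, hε, hlen⟩ := eps_anatomy hP.1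
    have hmw := (Finset.mem_filter.1 hP.1).1
    rw [mem_midWalks_iff] at hmw
    have hle := length_inner_le hmw
    rw [inner_cons_append] at hle ⊢
    exact ⟨toPair_mem_spTarget hT hl hc hnd hV (by omega), by dsimp only; omega⟩


/-! ### `ε`-walks with contacts: the last-contact split -/

/-- Anatomy of an `ε`-walk WITH a contact, around its last contact `v = l[j]`, `j = lcIdx (T-1) l`: the prefix
`l.take (j+1)` is a bridge of `S_{T,L}` carrying all the contacts, the suffix `l.drop j` (from `v` on) is a self-avoiding
vertex list of `S_{T,L}`, and `|prefix| + |suffix| = |l| + 1 ≥ L + 2`.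
[cite: BeatonBousquetMelouDeGierDuminilCopinGuttmann2014, §4.5 (last contact) and proof of Proposition 9 (§4.3, arXiv v5 p. 14)] -/
theorem eps_contact_anatomy (hT : 1 ≤ T) {P : List HV}
    (hP : P ∈ (epsWalks T L).filter fun P => ∃ x ∈ inner P, lev x = 2 * (T : ℤ) - 1) :
    ∃ (l : List HV) (u : HV) (hl : l ≠ []), P = wOut :: (l ++ [u]) ∧ l.IsChain hvGraph.Adj ∧ l.head? = some hvOrigin ∧
      l.Nodup ∧ (∀ x ∈ l, x ∈ stripV T L) ∧ IsEpsDart L (l.getLast hl, u) ∧ L + 1 ≤ l.length ∧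
      lcIdx (T - 1) l < l.length ∧
      l.take (lcIdx (T - 1) l + 1) ∈ bridgeLists T L ∧
      ((l.take (lcIdx (T - 1) l + 1)).filter fun v => lev v = 2 * (T : ℤ) - 1).length =
        (l.filter fun v => lev v = 2 * (T : ℤ) - 1).length ∧
      l.drop (lcIdx (T - 1) l) ≠ [] ∧ (l.drop (lcIdx (T - 1) l)).head? = l[lcIdx (T - 1) l]? := by
  rw [Finset.mem_filter] at hP
  obtain ⟨hP, x, hx, hxlev⟩ := hP
  obtain ⟨l, u, hl, rfl, hc, hh, hnd, hV, hε, hlen⟩ := eps_anatomy hP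
  rw [inner_cons_append] at hx
  obtain ⟨i₀, hi₀, rfl⟩ := List.mem_iff_getElem.1 hx
  have hTT : (2 * ((T - 1 : ℕ) : ℤ) + 1) = 2 * (T : ℤ) - 1 := by push_cast [hT]; ring
  obtain ⟨⟨hj, hlevj⟩, hafter⟩ := lcIdx_spec (T := T - 1) (l := l) hi₀ (by rw [hTT]; exact hxlev)
  rw [hTT] at hlevj
  refine ⟨l, u, hl, rfl, hc, hh, hnd, hV, hε, hlen, hj, ?_, ?_, ?_, ?_⟩
  · -- the prefix is a bridge of `S_{T,L}`
    rw [mem_bridgeLists_iff hT]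
    have hne : l.take (lcIdx (T - 1) l + 1) ≠ [] := by simp [hl]
    refine ⟨hc.take _, by rw [List.head?_take]; simpa using hh, hnd.sublist (List.take_sublist _ _),
      fun x hx => hV x (List.mem_of_mem_take hx), hne, ?_⟩
    have hlt : (l.take (lcIdx (T - 1) l + 1)).getLast hne = l[lcIdx (T - 1) l] := by
      simp [List.getLast_eq_getElem, List.getElem_take, Nat.min_eq_left (show lcIdx (T - 1) l + 1 ≤ l.length by omega)]
    rw [hlt, hlevj]
  · -- all contacts are in the prefix
    conv_rhs => rw [← List.take_append_drop (lcIdx (T - 1) l + 1) l]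
    rw [List.filter_append, List.length_append]
    suffices h : ((l.drop (lcIdx (T - 1) l + 1)).filter fun v => lev v = 2 * (T : ℤ) - 1) = [] by
      rw [h, List.length_nil, add_zero]
    rw [List.filter_eq_nil_iff]
    intro v hv
    obtain ⟨k, hk, rfl⟩ := List.mem_iff_getElem.1 hv
    rw [List.getElem_drop]
    rw [List.length_drop] at hk
    have := hafter (lcIdx (T - 1) l + 1 + k) (by omega) (by omega)
    rw [hTT] at this
    simpa using this
  · simp; omega
  · rw [List.head?_drop]

/-- The «big» filter on pairs (prefix, tagged suffix): long prefix or long suffix. [cite: BeatonBousquetMelouDeGierDuminilCopinGuttmann2014, proof of Proposition 9] -/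
def EpsBig (L : ℕ) (q : List HV × (Σ _ : ℕ, Site 2 × (ℕ → Site 2))) : Prop :=
  L / 2 + 1 ≤ q.1.length ∨ L / 2 ≤ q.2.1

/-- `EpsBig` is decidable. -/
instance (L : ℕ) : DecidablePred (EpsBig L) := fun q => by unfold EpsBig; infer_instance

/-- The weight on pairs. [cite: BeatonBousquetMelouDeGierDuminilCopinGuttmann2014, proof of Proposition 9] -/
def pairWt (T : ℕ) (y : ℝ) (q : List HV × (Σ _ : ℕ, Site 2 × (ℕ → Site 2))) : ℝ :=
  (hexCriticalFugacity ^ q.1.length * y ^ (q.1.filter fun v => lev v = 2 * (T : ℤ) - 1).length) *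
    hexCriticalFugacity ^ q.2.1

/-- **`ε`-walks with contacts**: their weight injects into (bridge of `S_{T,L}` carrying the contacts, tagged strip
pair of the suffix), with a long prefix or a long suffix. [cite: BeatonBousquetMelouDeGierDuminilCopinGuttmann2014, §4.5 (last contact) and proof of Proposition 9 (§4.3, arXiv v5 p. 14)] -/
theorem sum_eps_contact_le (hT : 1 ≤ T) {y : ℝ} (hy : 0 ≤ y) :
    ∑ P ∈ (epsWalks T L).filter (fun P => ∃ x ∈ inner P, lev x = 2 * (T : ℤ) - 1),
        hexCriticalFugacity ^ mwLen P * y ^ surfContacts T P ≤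
      ∑ q ∈ (bridgeLists T L ×ˢ spTarget T ((stripV T L).card)).filter (EpsBig L), pairWt T y q := by
  classical
  have hx := hexCriticalFugacity_pos_lt_one
  set N := (stripV T L).card
  set Φ : List HV → List HV × (Σ _ : ℕ, Site 2 × (ℕ → Site 2)) := fun P =>
    ((inner P).take (lcIdx (T - 1) (inner P) + 1),
      ⟨((inner P).drop (lcIdx (T - 1) (inner P))).length - 1, toPair ((inner P).drop (lcIdx (T - 1) (inner P)))⟩)
    with hΦ
  -- weights agree
  have hw : ∀ P ∈ (epsWalks T L).filter (fun P => ∃ x ∈ inner P, lev x = 2 * (T : ℤ) - 1),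
      hexCriticalFugacity ^ mwLen P * y ^ surfContacts T P = pairWt T y (Φ P) := by
    intro P hP
    obtain ⟨l, u, hl, rfl, -, -, -, -, -, -, hj, -, hcnt, -, -⟩ := eps_contact_anatomy hT hP
    rw [mwLen_cons_append, surfContacts, hΦ]
    simp only [inner_cons_append, pairWt]
    rw [hcnt, List.length_take, List.length_drop, Nat.min_eq_left (by omega), mul_assoc, mul_comm (y ^ _),
      ← mul_assoc, ← pow_add, show lcIdx (T - 1) l + 1 + (l.length - lcIdx (T - 1) l - 1) = l.length by omega]
  rw [Finset.sum_congr rfl hw]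
  refine sum_le_sum_of_injOn_of_nonneg Φ ?_ ?_ (pairWt T y)
    (fun _ _ => mul_nonneg (mul_nonneg (pow_nonneg hx.1.le _) (pow_nonneg hy _)) (pow_nonneg hx.1.le _))
  · -- injective
    intro P hP P' hP' h
    obtain ⟨l, u, hl, rfl, hc, hh, hnd, hV, hε, -, hj, -, -, hr, hrh⟩ := eps_contact_anatomy hT hP
    obtain ⟨l', u', hl', rfl, hc', hh', hnd', hV', hε', -, hj', -, -, hr', hrh'⟩ := eps_contact_anatomy hT hP'
    rw [hΦ] at h
    simp only [inner_cons_append, Prod.mk.injEq, Sigma.mk.inj_iff] at h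
    obtain ⟨h1, hlen, hpair⟩ := h
    have hjj : lcIdx (T - 1) l = lcIdx (T - 1) l' := by
      have := congrArg List.length h1
      simp only [List.length_take] at this
      omega
    -- the suffixes have the same head (`l[j] = l'[j]`, read off the prefixes) and length
    have hheads : (l.drop (lcIdx (T - 1) l)).head? = (l'.drop (lcIdx (T - 1) l')).head? := by
      rw [hrh, hrh']
      have e1 : (l.take (lcIdx (T - 1) l + 1))[lcIdx (T - 1) l]? = l[lcIdx (T - 1) l]? :=
        List.getElem?_take_of_lt (by omega)
      have e2 : (l'.take (lcIdx (T - 1) l' + 1))[lcIdx (T - 1) l]? = l'[lcIdx (T - 1) l']? := by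
        rw [hjj]; exact List.getElem?_take_of_lt (by omega)
      rw [h1] at e1
      exact e1.symm.trans e2
    have hll' : (l.drop (lcIdx (T - 1) l)).length = (l'.drop (lcIdx (T - 1) l')).length := by
      have : 0 < (l.drop (lcIdx (T - 1) l)).length := List.length_pos_of_ne_nil hr
      have : 0 < (l'.drop (lcIdx (T - 1) l')).length := List.length_pos_of_ne_nil hr'
      omega
    have hdrop : l.drop (lcIdx (T - 1) l) = l'.drop (lcIdx (T - 1) l') :=
      toPair_inj hr hr' hheads hll' (eq_of_heq hpair)
    have htake : l.take (lcIdx (T - 1) l) = l'.take (lcIdx (T - 1) l') := by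
      have := congrArg (List.take (lcIdx (T - 1) l)) h1
      rw [List.take_take, List.take_take] at this
      rw [hjj] at this ⊢
      rw [Nat.min_eq_left (Nat.le_succ _)] at this
      exact this
    have hll : l = l' := by
      rw [← List.take_append_drop (lcIdx (T - 1) l) l, ← List.take_append_drop (lcIdx (T - 1) l') l', htake, hdrop]
    subst hll
    have hz := (mem_stripV_iff.1 (hV _ (List.getLast_mem hl))).1
    rw [eps_exit_unique hz hε hε']
  · -- lands in the filtered product
    intro P hP
    obtain ⟨l, u, hl, hPeq, hc, hh, hnd, hV, hε, hlen, hj, hbr, -, hr, -⟩ := eps_contact_anatomy hT hP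
    rw [Finset.mem_filter, Finset.mem_product, hΦ, hPeq]
    simp only [inner_cons_append]
    have hmw : IsMidWalk (stripV T L) (wOut :: (l ++ [u])) := by
      have := (Finset.mem_filter.1 (Finset.mem_filter.1 hP).1).1
      rw [hPeq] at this; exact mem_midWalks_iff.1 this
    have hle := length_inner_le hmw
    rw [inner_cons_append] at hle
    refine ⟨⟨hbr, toPair_mem_spTarget hT hr (hc.drop _) (hnd.sublist (List.drop_sublist _ _))
      (fun x hx => hV x (List.mem_of_mem_drop hx)) (by rw [List.length_drop]; omega)⟩, ?_⟩
    unfold EpsBig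
    dsimp only
    rw [List.length_take, List.length_drop, Nat.min_eq_left (by omega)]
    omega

end Literature.Probability.RandomPlanarGeometry.SAW.HV
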